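import Literature.AlgebraicGeometry.Surfaces.K3SurfaceProofs
import Literature.LinearAlgebra.QuadraticForm.HyperbolicReflectionDescent
import HarnessLib

/-!
# Weyl-group descent in the K3 lattice (lattice half of Huybrechts Ch. 8 Cor. 2.9, marked form)

Family `hodge`, layer `Literature/AlgebraicGeometry/Surfaces`. The abstract descent
`Literature.LinearAlgebra.QuadraticForm.exists_foldr_rootReflection_nonneg` (a hyperbolic integral
lattice, reflections `s_δ(u) = u + (u.δ) δ` in roots `δ² = −2`) specialised to the K3 lattice
`Λ = (K3Index → ℤ, k3Gram)` and to the sublattice `Λ ∩ x^⊥` of a period `x ∈ Λ_ℂ` — under a marking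
of a projective K3 surface `S` with period `x` this is `NS(S)` (Lefschetz `(1,1)`), its roots are the
`(−2)`-classes, and for `h` ample the positive roots (`(δ.h) > 0`) are the effective ones
(Riemann–Roch) — together with the dictionary to the tree's complexified reflections
`k3ReflectionC` (`K3SurfaceProofs`): on integral vectors and for a root `δ`,
`k3ReflectionC δ = s_δ` and a word `(l.map k3ReflectionC).prod` is the `List.foldr` word.

* `k3Form_intCast_eq_toBilin'`, `toBilin'_k3Gram_comm` — the integral form `Matrix.toBilin' k3Gram`
  under `k3Form`.
* `k3ReflectionC_intCast_of_root`, `listProd_k3ReflectionC_intCast_of_roots` — the dictionary.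
* `K3_exists_word_rootReflection_nonneg` — **Cor. 8.2.9, lattice half, in the K3 lattice**: for a
  period `x`, a class `h ∈ Λ ∩ x^⊥` with `h² > 0` such that `h^⊥ ∩ x^⊥ ∩ Λ` is negative
  semi-definite (Hodge index on `NS(S)`), and `α ∈ Λ ∩ x^⊥` with `α² > 0`, `(α.h) > 0`, there is a
  word `l` of positive roots orthogonal to `x` with `β = w(α)` on the side of `h`, `(β.δ) ≥ 0` for
  every positive root `δ ⊥ x`, and `(l.map k3ReflectionC).prod α = β` on `Λ_ℂ`. This is the lattice
  input of the global Torelli theorem in marked form (Huybrechts Ch. 7 Thm. 5.3 with Ch. 8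
  Cor. 2.9: a Hodge isometry is composed with such a word and a sign until it preserves the ample
  cone), the shape consumed by `corr_of_markedTorelliData` (`K3SurfaceBuskinReflectiveProofs`).

Everything is proved; no named facts. Not here: Riemann–Roch for `(−2)`-classes, the ample cone,
the Hodge index theorem, global Torelli.

## References

* [Huybrechts2016K3] D. Huybrechts, Lectures on K3 Surfaces, CUP 2016, Ch. 8 §1.2 Cor. 1.6–1.7,
  §2.1–2.4, Cor. 2.9, Remark 2.10; Ch. 7 Thm. 5.3.
* [Buskin2019] N. Buskin, Every rational Hodge isometry between two K3 surfaces is algebraic,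
  J. reine angew. Math. 755 (2019), §1 (the Torelli case) and §6.2.
-/

noncomputable section

open Literature.LinearAlgebra.QuadraticForm

namespace Literature.AlgebraicGeometry.Surfaces

/-! ### The integral K3 form under `k3Form` -/

/-- On integral vectors `k3Form` is the integral lattice form `Matrix.toBilin' k3Gram`.
[cite: Huybrechts2016K3, Ch. 1 §3.3] -/
theorem k3Form_intCast_eq_toBilin' (u v : K3Index → ℤ) :
    k3Form (fun i => (u i : ℂ)) (fun i => (v i : ℂ)) = ((Matrix.toBilin' k3Gram u v : ℤ) : ℂ) := by
  rw [k3Form_intCast, Matrix.toBilin'_apply']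
  simp only [dotProduct, Matrix.mulVec, Finset.mul_sum, mul_assoc]

/-- The integral K3 form is symmetric. [cite: Huybrechts2016K3, Ch. 1 §3.3 and Ch. 14 §0.1] -/
theorem toBilin'_k3Gram_comm (u v : K3Index → ℤ) :
    Matrix.toBilin' k3Gram u v = Matrix.toBilin' k3Gram v u := by
  have h := k3Form_comm (fun i => (u i : ℂ)) (fun i => (v i : ℂ))
  rw [k3Form_intCast_eq_toBilin', k3Form_intCast_eq_toBilin'] at h
  exact_mod_cast h

/-! ### Dictionary: `k3ReflectionC` on integral vectors is the root reflection -/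

/-- For a root `δ ∈ Λ` (`δ² = −2`) and `u ∈ Λ`: `k3ReflectionC δ u = u + (u.δ) δ`
(`s_δ(x) = x − (2 (δ.x)/(δ.δ)) δ` with `(δ.δ) = −2`). [cite: Huybrechts2016K3, Ch. 8 §2.2] -/
theorem k3ReflectionC_intCast_of_root (δ u : K3Index → ℤ) (hδ : Matrix.toBilin' k3Gram δ δ = -2) :
    k3ReflectionC δ (fun i => (u i : ℂ)) =
      fun i => ((u + Matrix.toBilin' k3Gram u δ • δ) i : ℂ) := by
  rw [k3ReflectionC_apply, k3Form_intCast_eq_toBilin', k3Form_intCast_eq_toBilin', hδ,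
    toBilin'_k3Gram_comm δ u]
  ext i
  simp only [Pi.sub_apply, Pi.smul_apply, smul_eq_mul, Pi.add_apply, Int.cast_add, Int.cast_mul,
    Int.cast_neg, Int.cast_ofNat]
  ring

/-- A word of `k3ReflectionC`'s in roots acts on integral vectors as the `List.foldr` word of root
reflections `u ↦ u + (u.δ) δ`. [cite: Huybrechts2016K3, Ch. 8 §2.2–2.3] -/
theorem listProd_k3ReflectionC_intCast_of_roots (l : List (K3Index → ℤ))
    (hl : ∀ δ ∈ l, Matrix.toBilin' k3Gram δ δ = -2) (u : K3Index → ℤ) :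
    (l.map k3ReflectionC).prod (fun i => (u i : ℂ)) =
      fun i => ((l.foldr (fun δ v => v + Matrix.toBilin' k3Gram v δ • δ) u) i : ℂ) := by
  induction l with
  | nil => simp
  | cons δ l ih =>
    rw [List.map_cons, List.prod_cons, Module.End.mul_apply,
      ih fun δ' h' => hl δ' (List.mem_cons_of_mem δ h'), List.foldr_cons,
      k3ReflectionC_intCast_of_root δ _ (hl δ List.mem_cons_self)]

/-! ### The descent in `Λ ∩ x^⊥` -/

/-- **Huybrechts Ch. 8 Cor. 2.9, lattice half, in the K3 lattice.** Let `x ∈ Λ_ℂ` (a period),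
`h ∈ Λ ∩ x^⊥` with `h² > 0` such that `Λ ∩ x^⊥ ∩ h^⊥` is negative semi-definite (the Hodge index
theorem on `NS(S) = Λ ∩ x^⊥` of a projective K3 surface with period `x` and ample class `h`), and
`α ∈ Λ ∩ x^⊥` with `α² > 0`, `(α.h) > 0`. Then there is a word `l = [δ₁, …, δ_k]` of positive roots
orthogonal to `x` (`δᵢ² = −2`, `(δᵢ.h) > 0`, `(δᵢ.x) = 0`; for `S`: effective `(−2)`-classes) such
that `β := (s_{δ₁} ∘ ⋯ ∘ s_{δ_k})(α)` satisfies `(β.h) > 0`, `(β.δ) ≥ 0` for every positive root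
`δ ⊥ x` (for `S`: `β` nef), and `(l.map k3ReflectionC).prod α = β` in `Λ_ℂ`
(`exists_foldr_rootReflection_nonneg` on the sublattice `Λ ∩ x^⊥`, and the dictionary
`listProd_k3ReflectionC_intCast_of_roots`). [cite: Huybrechts2016K3, Ch. 8 Cor. 2.9 and Remark 2.10] -/
theorem K3_exists_word_rootReflection_nonneg (x : K3Index → ℂ) (h : K3Index → ℤ)
    (hhx : k3Form (fun i => (h i : ℂ)) x = 0) (hh : 0 < Matrix.toBilin' k3Gram h h)
    (hHI : ∀ a : K3Index → ℤ, k3Form (fun i => (a i : ℂ)) x = 0 → Matrix.toBilin' k3Gram a h = 0 →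
      Matrix.toBilin' k3Gram a a ≤ 0)
    (α : K3Index → ℤ) (hαx : k3Form (fun i => (α i : ℂ)) x = 0) (hα : 0 < Matrix.toBilin' k3Gram α α)
    (hαh : 0 < Matrix.toBilin' k3Gram α h) :
    ∃ l : List (K3Index → ℤ),
      (∀ δ ∈ l, Matrix.toBilin' k3Gram δ δ = -2 ∧ 0 < Matrix.toBilin' k3Gram δ h ∧
        k3Form (fun i => (δ i : ℂ)) x = 0) ∧
      0 < Matrix.toBilin' k3Gram (l.foldr (fun δ v => v + Matrix.toBilin' k3Gram v δ • δ) α) h ∧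
      (∀ δ : K3Index → ℤ, Matrix.toBilin' k3Gram δ δ = -2 → 0 < Matrix.toBilin' k3Gram δ h →
        k3Form (fun i => (δ i : ℂ)) x = 0 →
        0 ≤ Matrix.toBilin' k3Gram (l.foldr (fun δ v => v + Matrix.toBilin' k3Gram v δ • δ) α) δ) ∧
      (l.map k3ReflectionC).prod (fun i => (α i : ℂ)) =
        fun i => ((l.foldr (fun δ v => v + Matrix.toBilin' k3Gram v δ • δ) α) i : ℂ) := by
  -- the sublattice `Λ ∩ x^⊥`
  let W : Submodule ℤ (K3Index → ℤ) :=
    { carrier := {u | k3Form (fun i => (u i : ℂ)) x = 0}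
      add_mem' := fun {a b} ha hb => by
        simp only [Set.mem_setOf_eq] at ha hb ⊢
        have : (fun i => ((a + b) i : ℂ)) = (fun i => (a i : ℂ)) + fun i => (b i : ℂ) := by
          ext i; simp
        rw [this, k3Form_add_left, ha, hb, add_zero]
      zero_mem' := by
        simp only [Set.mem_setOf_eq]
        have : (fun i => ((0 : K3Index → ℤ) i : ℂ)) = 0 := by ext i; simp
        rw [this, k3Form_zero_left]
      smul_mem' := fun c {a} ha => by
        simp only [Set.mem_setOf_eq] at ha ⊢
        have : (fun i => ((c • a) i : ℂ)) = (c : ℂ) • fun i => (a i : ℂ) := by ext i; simp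
        rw [this, k3Form_smul_left, ha, mul_zero] }
  have hW : ∀ u : K3Index → ℤ, u ∈ W ↔ k3Form (fun i => (u i : ℂ)) x = 0 := fun u => Iff.rfl
  let B : LinearMap.BilinForm ℤ W := (Matrix.toBilin' k3Gram).domRestrict₁₂ W W
  have hB : ∀ a b : W, B a b = Matrix.toBilin' k3Gram a b := fun a b => rfl
  have hBs : ∀ a b : W, B a b = B b a := fun a b => by rw [hB, hB, toBilin'_k3Gram_comm]
  -- the `foldr` word on `W` projects to the `foldr` word on `Λ`
  have hfold : ∀ (l : List W) (a : W),
      ((l.foldr (fun δ v => v + B v δ • δ) a : W) : K3Index → ℤ) =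
        (l.map Subtype.val).foldr (fun δ v => v + Matrix.toBilin' k3Gram v δ • δ) a := by
    intro l a
    induction l with
    | nil => simp
    | cons δ l ih =>
      rw [List.foldr_cons, List.map_cons, List.foldr_cons, Submodule.coe_add, Submodule.coe_smul,
        ih, hB, ih]
  obtain ⟨l, hl, hlh, hnef⟩ := exists_foldr_rootReflection_nonneg B hBs ⟨h, (hW h).2 hhx⟩ hh
    (fun a ha => hHI a a.2 ha) ⟨α, (hW α).2 hαx⟩ hα hαh
  refine ⟨l.map Subtype.val, fun δ hδ => ?_, ?_, fun δ hδ hδh hδx => ?_,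
    listProd_k3ReflectionC_intCast_of_roots _ (fun δ hδ => ?_) α⟩
  · obtain ⟨δ', hδ', rfl⟩ := List.mem_map.1 hδ
    exact ⟨(hl δ' hδ').1, (hl δ' hδ').2, δ'.2⟩
  · have h' := hlh
    rw [hB, hfold] at h'
    exact h'
  · have h' := hnef ⟨δ, (hW δ).2 hδx⟩ hδ hδh
    rw [hB, hfold] at h'
    exact h'
  · obtain ⟨δ', hδ', rfl⟩ := List.mem_map.1 hδ
    exact (hl δ' hδ').1

end Literature.AlgebraicGeometry.Surfaces

end
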